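import Literature.MathematicalPhysics.QuantumLattice.HubbardTTPrimeThermalWindowCertificate
import Literature.MathematicalPhysics.QuantumLattice.TorusSectorGibbsMixtureSymmetry
import HarnessLib

/-!
# `t–t'` Hubbard model at `T > 0`: `D₄`-REDUCED thermal window certificates bound every thermal
# torus-limit state, with the density terms evaluated

Topic `Literature/MathematicalPhysics/QuantumLattice`; complement of
`HubbardTTPrimeThermalWindowCertificate.lean` (§3 there reads TRANSLATION-reduced thermal certificates,
`γₗ = 1`, in torus limits of canonical sector Gibbs states). Thermal torus limits are point-group
invariant (`IsTorusLimitOfMixture.isD4Invariant_of_sectorGibbs`, `TorusSectorGibbsMixtureSymmetry.lean`: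
a Gibbs state is a function of the Hamiltonian — no degeneracy caveat at `T > 0`), so the affine-`D₄`
defects `Γ(incl)(Γ(d4Emb γₗ wₗ Λ) Yₗ) − Γ(incl) Yₗ` of a certificate with ARBITRARY point-group labels
`γₗ ∈ D₄` are `ω`-null (`IsTorusLimitOfMixture.expect_d4Defect_eq_zero_of_sectorGibbs`), and the spin
densities of an `S^z = 0` canonical limit are `Re ω(n_{0σ}) = n/2`
(`IsTorusLimitOfMixture.re_expect_nAt_eq_of_sectorGibbs`, `TorusSectorGibbsMixtureChargeRows.lean`).
Hence:

* `IsTorusLimitOfMixture.re_expect_ge_of_thermal_certificate_d4_TT'_of_sectorGibbs` — for `ω` a torus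
  limit of the canonical Gibbs states of `hubbardTorusTT' (Ls j) t t' U` at inverse temperature `β` on
  the sectors `(rectN n (Ls j), S^z = 0)` (`0 ≤ n ≤ 2`, `Ls → ∞`), every thermal window certificate
  (identity of `re_expect_ge_of_thermal_certificate_TT'_of_rows`, `thicken Λ 1 ⊆ Λ'`, arbitrary `γₗ`,
  charged words with nonzero particle or spin charge, EEB generators conserving the local `N` and `S^z`
  with `e^{sᵣ−1} ≤ qᵣ`, `λᵣ ≥ 0`, extra rows `Gₑ` with `κₑ ≥ 0` on which `ω` is nonnegative) proves
  `c − Σₖ ‖aₖ‖ + (Σ_σ μ_σ)(n/2 − ν) + κ (u − e^{tt'}(ω)) ≤ Re ω_{Λ'}(Xw)`.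

The only undischarged hypotheses are the extra rows `Gₑ` (supplied by name, e.g. the cut row
`energyDensityTT' ≤ e^{tt'}(ω)` and the cap row of `TorusSectorGibbsMixture`, or none). Sources:
Fawzi–Fawzi–Scalet 2024 §3.2–3.3 (EEB-constrained relaxations bracket the expectations of every
translation-invariant KMS state; symmetry reduction) [FawziFawziScalet2024]; Han 2020 §3 (the
square-lattice constraint set) [Han2020Bootstrap]. Everything is PROVED; no definition, no named fact.
-/

noncomputable section

namespace Literature.MathematicalPhysics.QuantumLattice

open Matrix Finset HubbardWave0 Literature.Probability.LatticeModels ThermodynamicLimit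
open Literature.MathematicalPhysics.QuantumManyBody.StateRelaxation
open _root_.Filter
open scoped _root_.Topology ComplexOrder BigOperators

namespace InfVolFermionState

/-- **`D₄`-reduced thermal window certificates bound every thermal torus-limit state, densities
evaluated.** Let `ω` be a torus limit of the canonical Gibbs states of `hubbardTorusTT' (Ls j) t t' U` at
inverse temperature `β` on the sectors `(rectN n (Ls j), S^z = 0)` (`0 ≤ n ≤ 2`, `Ls → ∞`). Then every
thermal window certificate — the operator identity of `re_expect_ge_of_thermal_certificate_TT'_of_rows`
in `𝔄_{Λ'}` with `thicken Λ 1 ⊆ Λ'`, ARBITRARY affine-`D₄` labels `γₗ`, charged words `Wⱼ` of nonzero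
particle or spin charge, energy–entropy-balance generators `Aᵣ ∈ 𝔄_Λ` commuting with the local `N` and
`S^z`, slopes `e^{sᵣ−1} ≤ qᵣ`, multipliers `λᵣ, κₑ ≥ 0`, and extra rows `Gₑ` with `0 ≤ Re ω_{Λ'}(Gₑ)` —
proves `c − Σₖ ‖aₖ‖ + (Σ_σ μ_σ)(n/2 − ν) + κ (u − e^{tt'}(ω)) ≤ Re ω_{Λ'}(Xw)`: eom rows by
stationarity, defects by translation AND point-group invariance of thermal torus limits, charged words
by gauge invariance, EEB rows by `re_expect_eeb_nonneg_of_sectorGibbs_of_thicken_subset`, densities by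
`re_expect_nAt_eq_of_sectorGibbs`. [cite: FawziFawziScalet2024, Thm. 3.6] -/
theorem IsTorusLimitOfMixture.re_expect_ge_of_thermal_certificate_d4_TT'_of_sectorGibbs
    (t t' U : ℝ) {n : ℝ} (hn0 : 0 ≤ n) (hn2 : n ≤ 2) (β : ℝ) {ω : InfVolFermionState 2} {Ls : ℕ → ℕ}
    (h : ω.IsTorusLimitOfMixture (sectorGibbsCount n) (fun L => sectorGibbsWeightTT' β t t' U n L)
      (fun L => sectorGibbsVectorTT' t t' U n L) Ls)
    (hLs : Tendsto Ls atTop atTop)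
    {Λ Λ' : Finset (Site 2)} (hΛ : Λ ⊆ Λ') (h8 : thicken Λ 1 ⊆ Λ')
    (h0 : thicken ({0} : Finset (Site 2)) 1 ⊆ Λ') (hz : (0 : Site 2) ∈ Λ')
    (Xw : FermionOp Λ') (κ u : ℝ) (μ : Fin 2 → ℝ) (ν : ℝ)
    {m : Type*} [Fintype m] [DecidableEq m] {Λm : Matrix m m ℂ} (hΛm : Λm.PosSemidef)
    (O : m → FermionOp Λ')
    {κ' : Type*} (s : Finset κ') (B : κ' → FermionOp Λ)
    {ι : Type*} (tt : Finset ι) (γ : ι → DihedralGroup 4) (wv : ι → Site 2)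
    (hsh : ∀ l, d4ShiftSet (γ l) (wv l) Λ ⊆ Λ') (Y : ι → FermionOp Λ)
    {ρ : Type*} (uu : Finset ρ) (b : ρ → ℂ) (cw : ρ → List (Orb (PolySite Λ') × Bool))
    (hcw : ∀ j ∈ uu, ladderCharge (cw j) ≠ 0 ∨ ladderSpinCharge (cw j) ≠ 0)
    {θ : Type*} (rr : Finset θ) (lam : θ → ℝ) (hlam : ∀ r ∈ rr, 0 ≤ lam r) (A : θ → FermionOp Λ)
    (hAN : ∀ r ∈ rr, Commute (A r) (totalNumber : FermionOp Λ))
    (hAS : ∀ r ∈ rr, Commute (A r) (HubbardWave0.spinZ : FermionOp Λ))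
    (sv qv : θ → ℝ) (hq : ∀ r ∈ rr, Real.exp (sv r - 1) ≤ qv r)
    {η : Type*} (gg : Finset η) (kap : η → ℝ) (hkap : ∀ e ∈ gg, 0 ≤ kap e) (G : η → FermionOp Λ')
    (hG : ∀ e ∈ gg, 0 ≤ (ω.expect Λ' (G e)).re)
    {δ : Type*} (ah : Finset δ) (dc : δ → ℝ) (V : δ → FermionOp Λ')
    {κ'' : Type*} (w : Finset κ'') (a : κ'' → ℂ) (word : κ'' → List (Orb (PolySite Λ') × Bool)) {c : ℝ}
    (hcert : Xw - (c : ℂ) • (1 : FermionOp Λ') -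
        ∑ σ : Fin 2, ((μ σ : ℝ) : ℂ) • (nAt 0 hz σ - ((ν : ℝ) : ℂ) • (1 : FermionOp Λ')) -
        ((κ : ℝ) : ℂ) • (((u : ℝ) : ℂ) • (1 : FermionOp Λ') -
          fermionEmbed (PolySite.incl h0) ((hubbardTTPrimeFermionInteraction t t' U).meanEnergyObs 1)) =
      gramForm Λm O +
        (∑ k ∈ s, ((hubbardTTPrimeFermionInteraction t t' U).localHamiltonian Λ' * fermionEmbed (PolySite.incl hΛ) (B k) -
            fermionEmbed (PolySite.incl hΛ) (B k) * (hubbardTTPrimeFermionInteraction t t' U).localHamiltonian Λ') +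
          ∑ l ∈ tt, (fermionEmbed (PolySite.incl (hsh l)) (fermionEmbed (PolySite.d4Emb (γ l) (wv l) Λ) (Y l)) -
            fermionEmbed (PolySite.incl hΛ) (Y l)) +
          ∑ j ∈ uu, b j • ladderWord (cw j)) +
        (∑ r ∈ rr, ((lam r : ℝ) : ℂ) •
            (((β : ℝ) : ℂ) • ((fermionEmbed (PolySite.incl hΛ) (A r))ᴴ *
                ((hubbardTTPrimeFermionInteraction t t' U).localHamiltonian Λ' * fermionEmbed (PolySite.incl hΛ) (A r) -
                  fermionEmbed (PolySite.incl hΛ) (A r) * (hubbardTTPrimeFermionInteraction t t' U).localHamiltonian Λ')) -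
              ((sv r : ℝ) : ℂ) • ((fermionEmbed (PolySite.incl hΛ) (A r))ᴴ * fermionEmbed (PolySite.incl hΛ) (A r)) +
              ((qv r : ℝ) : ℂ) • (fermionEmbed (PolySite.incl hΛ) (A r) * (fermionEmbed (PolySite.incl hΛ) (A r))ᴴ)) +
          ∑ e ∈ gg, ((kap e : ℝ) : ℂ) • G e) +
        (∑ m' ∈ ah, ((dc m' : ℝ) : ℂ) • ((V m')ᴴ - V m') + ∑ k ∈ w, a k • ladderWord (word k))) :
    c - ∑ k ∈ w, ‖a k‖ + (∑ σ : Fin 2, μ σ) * (n / 2 - ν) +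
        κ * (u - ω.meanEnergy (hubbardTTPrimeFermionInteraction t t' U) 1) ≤
      (ω.expect Λ' Xw).re := by
  -- charged words, defects (translation + point group), eom rows, EEB rows
  have hch : ∀ j ∈ uu, ω.expect Λ' (ladderWord (cw j)) = 0 := fun j hj =>
    h.expect_ladderWord_eq_zero_of_sectorGibbs t t' U n β hLs (cw j) (hcw j hj)
  have hsym : ∀ l ∈ tt, ω.expect Λ'
      (fermionEmbed (PolySite.incl (hsh l)) (fermionEmbed (PolySite.d4Emb (γ l) (wv l) Λ) (Y l)) -
        fermionEmbed (PolySite.incl hΛ) (Y l)) = 0 := fun l _ =>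
    h.expect_d4Defect_eq_zero_of_sectorGibbs t t' U n β hLs hΛ (γ l) (wv l) (hsh l) (Y l)
  have heom : ∀ k ∈ s, ω.expect Λ'
      ((hubbardTTPrimeFermionInteraction t t' U).localHamiltonian Λ' * fermionEmbed (PolySite.incl hΛ) (B k) -
        fermionEmbed (PolySite.incl hΛ) (B k) * (hubbardTTPrimeFermionInteraction t t' U).localHamiltonian Λ') = 0 :=
    fun k _ => h.expect_commutator_localHamiltonian_eq_zero_of_sectorGibbs t t' U β hLs hΛ h8 (B k)
  have heeb : ∀ r ∈ rr, 0 ≤ (ω.expect Λ'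
      (((β : ℝ) : ℂ) • ((fermionEmbed (PolySite.incl hΛ) (A r))ᴴ *
          ((hubbardTTPrimeFermionInteraction t t' U).localHamiltonian Λ' * fermionEmbed (PolySite.incl hΛ) (A r) -
            fermionEmbed (PolySite.incl hΛ) (A r) * (hubbardTTPrimeFermionInteraction t t' U).localHamiltonian Λ')) -
        ((sv r : ℝ) : ℂ) • ((fermionEmbed (PolySite.incl hΛ) (A r))ᴴ * fermionEmbed (PolySite.incl hΛ) (A r)) +
        ((qv r : ℝ) : ℂ) • (fermionEmbed (PolySite.incl hΛ) (A r) * (fermionEmbed (PolySite.incl hΛ) (A r))ᴴ))).re :=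
    fun r hr => h.re_expect_eeb_nonneg_of_sectorGibbs_of_thicken_subset t t' U β hLs hΛ h8 (hAN r hr) (hAS r hr)
      (hq r hr)
  have hmain := ω.re_expect_ge_of_thermal_certificate_TT'_of_rows t t' U β hΛ h0 hz Xw κ u μ ν hΛm O s B tt γ wv
    hsh Y uu b cw rr lam A sv qv gg kap G ah dc V w a word hcert heom hsym hch hlam heeb hkap hG
  -- densities
  have hdens : ∑ σ : Fin 2, μ σ * ((ω.expect Λ' (nAt 0 hz σ)).re - ν) = (∑ σ : Fin 2, μ σ) * (n / 2 - ν) := by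
    rw [Finset.sum_mul]
    refine Finset.sum_congr rfl fun σ _ => ?_
    rw [h.re_expect_nAt_eq_of_sectorGibbs t t' U hn0 hn2 β hLs hz σ]
  rw [hdens] at hmain
  exact hmain

/-- **The thermal energy window from a `D₄`-reduced certificate**: under the hypotheses of
`re_expect_ge_of_thermal_certificate_d4_TT'_of_sectorGibbs` with objective `Xw = −Γ E^{tt'}_Φ`, no
density terms (`μ = 0`) and no energy term (`κ = 0`), the certificate is the certified UPPER bound
`e^{tt'}(ω) ≤ Σₖ ‖aₖ‖ − c`; with the variational lower bound (`U ≥ 0`, `n < 2`) the thermal energy per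
site of every such torus limit lies in `[energyDensityTT' t t' U n, Σₖ ‖aₖ‖ − c]` — by
`meanEnergy_mem_Icc_of_re_expect_ge_of_sectorGibbs` applied to the conclusion. (Restated here as the
one-line recipe; no new content.) [cite: FawziFawziScalet2024, Thm. 3.6] -/
theorem IsTorusLimitOfMixture.meanEnergy_le_of_re_expect_neg_ge_of_sectorGibbs
    (t t' U : ℝ) {ω : InfVolFermionState 2} {Λ' : Finset (Site 2)}
    (h0 : thicken ({0} : Finset (Site 2)) 1 ⊆ Λ') {c r : ℝ}
    (hub : c - r ≤ (ω.expect Λ'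
      (-fermionEmbed (PolySite.incl h0) ((hubbardTTPrimeFermionInteraction t t' U).meanEnergyObs 1))).re) :
    ω.meanEnergy (hubbardTTPrimeFermionInteraction t t' U) 1 ≤ r - c := by
  rw [map_neg, Complex.neg_re, ω.re_expect_fermionEmbed_meanEnergyObs _ 1 h0] at hub
  linarith

end InfVolFermionState

end Literature.MathematicalPhysics.QuantumLattice

end
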